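import Summits.RiemannHypothesis.RiemannHypothesis.Theorems.Splittings.NbTargetsDilation
import HarnessLib

/-!
# RH-EQUIVALENT·SPLITTING CENSUS (nb, neg) · V45 «DILATION BUDGET»: the cost of Nyman–Beurling approximation in the size of the dilations — a zero-cost inequality, bounded real menus ⟺ RH, and the one-parameter family DIL(η) polarised; nothing here bears on the truth of RH

LABEL (line 1): RH-EQUIVALENT·SPLITTING (cell `rh-split`, seat (nb, neg), generation 20, census
candidate V45).  Rows V1–V44 varied the target, the menu of dilations, the coefficients, the norm.
This file varies the BUDGET: how large the dilation parameters `t_j` (in `{t_j/x}`) must be for an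
`ε`-approximation of `χ = 𝟙_(0,1]` in `L²(0,∞)`.  Write, for a finite real menu `0 < t_j ≤ X` and
real `c_j`, `NB(ε; X)` for `‖χ - ∑ c_j {t_j/x}‖_{L²(0,∞)} < ε`, and for `η ∈ ℝ`

  DIL(η) : ∀ δ > 0 ∃ X ≥ 1, ε > 0, a menu in (0,X] with NB(ε; X) and ε·X^η < δ

(spelled out verbatim in every statement; this file declares no `def`).

* `norm_mellin_le_of_nbApprox` (RH-free, quantitative ZERO-CONFINEMENT for REAL menus): for a
  target `f` supported in `(0,1]` and ONE approximant `∑ c_j{1/(k_j x)}`, `k_j ≥ 1` real, at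
  `L²`-distance `< ε`: `‖∫_0^1 f x^{s-1}‖ ≤ ε (‖x^{s-1}‖_{L²(0,1)} + 1/|s-1|)` at every zero `s` of
  `ζ`, `1/2 < Re s < 1` (the tree's `NbTargets.mellin_eq_zero_of_nbTarget`, one approximant deep,
  real dilations).
* `nb_dilation_budget` (THE BUDGET INEQUALITY, RH-free): if `NB(ε; X)` with `X ≥ 1` then at every
  zero `ρ = β+iγ`, `1/2 < β < 1`:  `1/|ρ| ≤ ε · X^{β-1/2} · (‖x^{ρ-1}‖_{L²(0,1)} + 1/|ρ-1|)`
  (dilate by `X`: the menu lands in Báez-Duarte's range `k = X/t_j ≥ 1`, the target becomes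
  `𝟙_(0,1/X]` with Mellin transform `X^{-s}/s`, the error becomes `ε X^{-1/2}`).  Equivalently: an
  off-line zero forces `X ≥ (c_ρ/ε)^{1/(β-1/2)}` — approximation is possible only with dilations
  growing like a POWER of `1/ε`.
* `nb_real_menu_le_iff` : for every FIXED `X ≥ 1`, «`χ` is an `L²(0,∞)`-limit of combinations with
  real menus in `(0,X]`» ⟺ RH (bounded budget = Báez-Duarte's criterion again: COSTUME).
* `false_of_dil` : DIL(η) ⟹ `ζ` has no zero with `1/2 < Re s ≤ 1/2 + η` (RH-free).
* `rh_iff_dil_and_quasiRH` : for `η ≥ 0`, RH ⟺ DIL(η) ∧ QRH(1/2+η)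
  (`Literature.NumberTheory.LFunctions.QuasiRiemannHypothesis`): the splitting of the row.
* `dil_iff_rh_of_half_le` : for `η ≥ 1/2`, DIL(η) ⟺ RH (COSTUME end);  `dil_anti` : DIL is
  antitone in `η`;  `dil_of_neg` : for `η < 0`, DIL(η) holds outright (empty menu: VACUOUS end);
  `nb_real_menus_of_dil`/`dil_of_nonpos_of_nb_real_menus` : for `η ≥ 0`, resp. `η ≤ 0`, DIL(η)
  implies / is implied by plain density over all finite real menus (TRUE: Wiener + PNT, the cell's
  T47a) — so DIL(0) is DECORATION, and the open window is exactly `0 < η < 1/2`.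

Hygiene: zero `def`s, no `sorry`, no new axioms, no `instance`/`notation`, imports = the landed
`…Theorems.Splittings.NbTargetsDilation` (hence `NbTargets`, `NymanBeurlingBaezDuarteProofs`) +
`HarnessLib`.
-/

set_option linter.dupNamespace false

noncomputable section

open Complex Filter MeasureTheory Set
open scoped Real Topology

namespace Summit.RiemannHypothesis.RiemannHypothesis.Theorems.Splittings.NbDilationBudget

open Literature.NumberTheory.LFunctions
open Summit.RiemannHypothesis.RiemannHypothesis.Theorems.Splittings.NbTargets

/-- Bookkeeping: a nonnegative quantity bounded by `ε K` for every `ε > 0` cannot be positive.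
[folklore] -/
theorem false_of_forall_le_mul {a K : ℝ} (ha : 0 < a) (hK : 0 ≤ K)
    (h : ∀ ε : ℝ, 0 < ε → a ≤ ε * K) : False := by
  have h1 := h (a / (2 * (K + 1))) (by positivity)
  have hlt : a / (2 * (K + 1)) * K < a := by
    rw [div_mul_eq_mul_div, div_lt_iff₀ (by positivity)]
    nlinarith
  linarith

/-- **Quantitative zero confinement for real menus (RH-free).**  Let `f : ℝ → ℝ` be measurable,
square-integrable on `(0,∞)` and zero on `(1,∞)`, and let `∑_{j<J} c_j {1/(k_j x)}` with REAL
`k_j ≥ 1` be at `L²(0,∞)`-distance `< ε` from `f`.  Then at every zero `s` of `ζ` with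
`1/2 < Re s < 1`:  `‖∫_0^∞ f(x) x^{s-1} dx‖ ≤ ε · (‖𝟙_(0,1] x^{s-1}‖_{L²(0,∞)} + ‖1/(s-1)‖)`.
Proof verbatim as the tree's `NbTargets.mellin_eq_zero_of_nbTarget` (tail `-C/x` on `(1,∞)` with
`C = ∑ c_j/k_j`, `|C| ≤ ε`; Titchmarsh (2.1.5) at a zero, `∫_0^1{1/(kx)}x^{s-1}dx = 1/(k(s-1))`
for real `k ≥ 1` — `Literature.NumberTheory.LFunctions.mellin_beurlingRhoTrunc_eq`; Cauchy–Schwarz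
on `(0,1]`), kept one approximant deep. [cite: Balazard2020, Prop. 11; BaezDuarte2003, Thm. 1.1] -/
theorem norm_mellin_le_of_nbApprox {f : ℝ → ℝ} (hfm : Measurable f)
    (hf2 : MemLp f 2 (volume.restrict (Ioi 0)))
    (hf1 : ∀ x, 1 < x → f x = 0)
    {J : ℕ} {k c : Fin J → ℝ} (hk : ∀ j, 1 ≤ k j) {ε : ℝ} (hε : 0 < ε)
    (hN : eLpNorm (fun x : ℝ ↦ f x - ∑ j : Fin J, c j * Int.fract (1 / (k j * x))) 2
        (volume.restrict (Ioi 0)) < ENNReal.ofReal ε)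
    {s : ℂ} (hζ : riemannZeta s = 0) (hσ : 1 / 2 < s.re) (hσ1 : s.re < 1) :
    ‖mellin (fun x ↦ (f x : ℂ)) s‖ ≤
      ε * ((eLpNorm ((Ioc (0 : ℝ) 1).indicator fun x : ℝ ↦ (x : ℂ) ^ (s - 1)) 2
              (volume.restrict (Ioi 0))).toReal + ‖(1 : ℂ) / (s - 1)‖) := by
  set μ0 : Measure ℝ := volume.restrict (Ioi 0) with hμ0
  have hre : 0 < s.re := by linarith
  have hs1 : s ≠ 1 := fun h' ↦ by simp [h'] at hσ1
  -- the test function `g = 𝟙_{(0,1]} x^{s-1}` and its (finite) `L²` norm `M`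
  set g : ℝ → ℂ := (Ioc (0 : ℝ) 1).indicator fun x ↦ (x : ℂ) ^ (s - 1) with hg
  have hgm : AEStronglyMeasurable g μ0 := by
    refine (Measurable.indicator ?_ measurableSet_Ioc).aestronglyMeasurable
    exact Complex.measurable_ofReal.pow_const _
  have hgL2 : MemLp g 2 μ0 := by
    refine (memLp_two_iff_integrable_sq_norm hgm).2 ?_
    have hI : IntegrableOn (fun x : ℝ ↦ x ^ (2 * (s.re - 1))) (Ioc 0 1) μ0 :=
      (intervalIntegral.intervalIntegrable_rpow' (a := 0) (b := 1) (by linarith)).1.restrict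
    refine (hI.integrable_indicator measurableSet_Ioc).congr ?_
    filter_upwards [ae_restrict_mem measurableSet_Ioi] with x (hx : 0 < x)
    by_cases hx1 : x ∈ Ioc (0 : ℝ) 1
    · simp only [hg, indicator_of_mem hx1, norm_cpow_eq_rpow_re_of_pos hx, sub_re, one_re]
      rw [← Real.rpow_natCast, ← Real.rpow_mul hx.le]
      norm_num [mul_comm]
    · simp [hg, indicator_of_notMem hx1]
  set M : ℝ := (eLpNorm g 2 μ0).toReal with hM
  have hM0 : 0 ≤ M := ENNReal.toReal_nonneg
  -- the target in complex clothes, and its Mellin integrand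
  set F : ℝ → ℂ := (Ioc (0 : ℝ) 1).indicator fun x ↦ (f x : ℂ) with hF
  have hF_eq : ∀ x : ℝ, 0 < x → F x = (f x : ℂ) := by
    intro x hx
    by_cases hx1 : x ∈ Ioc (0 : ℝ) 1
    · rw [hF, indicator_of_mem hx1]
    · have h1x : 1 < x := not_le.1 fun h' ↦ hx1 ⟨hx, h'⟩
      rw [hF, indicator_of_notMem hx1, hf1 x h1x, Complex.ofReal_zero]
  have hFL2 : MemLp F 2 μ0 := by
    have : MemLp (fun x ↦ (f x : ℂ)) 2 μ0 := hf2.ofReal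
    exact MemLp.indicator measurableSet_Ioc this
  have hprodF : (fun x : ℝ ↦ (x : ℂ) ^ (s - 1) • F x) = F * g := by
    funext x
    simp only [Pi.mul_apply, smul_eq_mul, hF, hg]
    by_cases hx : x ∈ Ioc (0 : ℝ) 1
    · simp only [indicator_of_mem hx]; ring
    · simp only [indicator_of_notMem hx, mul_zero]
  have hintF : Integrable (fun x : ℝ ↦ (x : ℂ) ^ (s - 1) • F x) μ0 := by
    rw [hprodF]
    exact memLp_one_iff_integrable.1 (hgL2.mul' hFL2)
  have hmellin : mellin (fun x ↦ (f x : ℂ)) s = ∫ x in Ioi (0 : ℝ), (x : ℂ) ^ (s - 1) • F x := by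
    rw [mellin]
    refine setIntegral_congr_fun measurableSet_Ioi fun x (hx : 0 < x) ↦ ?_
    simp only [hF_eq x hx]
  set D : ℝ → ℝ := fun x ↦ f x - ∑ j : Fin J, c j * Int.fract (1 / (k j * x)) with hD
  have hDm : Measurable D := by
    refine hfm.sub (Finset.measurable_sum _ fun j _ ↦ ?_)
    exact measurable_const.mul (measurable_fract.comp (by fun_prop))
  set C : ℝ := ∑ j : Fin J, c j / k j with hC
  ------------------------------------------------------------------
  -- (i) the tail `x > 1` gives `|C| ≤ ε`
  ------------------------------------------------------------------
  have hDtail : ∀ x : ℝ, 1 < x → D x = -C * x⁻¹ := by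
    intro x hx
    have hx0 : 0 < x := by linarith
    simp only [hD, hf1 x hx, zero_sub, hC, neg_mul, Finset.sum_mul, neg_inj]
    refine Finset.sum_congr rfl fun j _ ↦ ?_
    have hkj : 0 < k j := by linarith [hk j]
    have hkj' : k j ≠ 0 := hkj.ne'
    rw [Int.fract_eq_self.2 ⟨by positivity, ?_⟩]
    · field_simp
    · rw [div_lt_one (by positivity)]; nlinarith [hk j]
  have hCε : |C| ≤ ε := by
    have h1 : eLpNorm D 2 (volume.restrict (Ioi 1)) < ENNReal.ofReal ε :=
      (eLpNorm_mono_measure D (Measure.restrict_mono_set _ (Ioi_subset_Ioi zero_le_one))).trans_lt hN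
    have h2 : eLpNorm D 2 (volume.restrict (Ioi 1)) =
        eLpNorm ((-C) • fun x : ℝ ↦ x⁻¹) 2 (volume.restrict (Ioi 1)) := by
      refine eLpNorm_congr_ae ?_
      filter_upwards [ae_restrict_mem measurableSet_Ioi] with x hx
      rw [hDtail x hx, Pi.smul_apply, smul_eq_mul]
    rw [h2, eLpNorm_const_smul, eLpNorm_inv_Ioi_one, mul_one, enorm_neg,
      Real.enorm_eq_ofReal_abs, ENNReal.ofReal_lt_ofReal_iff hε] at h1
    exact h1.le
  ------------------------------------------------------------------
  -- (ii) the pairing with `x^{s-1}` on `(0,1]` equals `mellin f s - C/(s-1)`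
  ------------------------------------------------------------------
  set Dc : ℝ → ℂ := (Ioc (0 : ℝ) 1).indicator fun x ↦ (D x : ℂ) with hDc
  have hDcm : Measurable Dc := (Complex.measurable_ofReal.comp hDm).indicator measurableSet_Ioc
  have hDc_eq : ∀ x : ℝ, Dc x = F x - ∑ j : Fin J, (c j : ℂ) * beurlingRhoTrunc (k j) x := by
    intro x
    by_cases hx : x ∈ Ioc (0 : ℝ) 1
    · simp only [hDc, hD, hF, beurlingRhoTrunc, indicator_of_mem hx]
      push_cast
      try rfl
    · simp only [hDc, hF, beurlingRhoTrunc, indicator_of_notMem hx, mul_zero,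
        Finset.sum_const_zero, sub_zero]
  have hmel : ∀ j : Fin J, mellin (beurlingRhoTrunc (k j)) s = 1 / ((k j : ℂ) * (s - 1)) := by
    intro j
    rw [mellin_beurlingRhoTrunc_eq (hk j) hre hs1, hζ, mul_zero, zero_div, sub_zero]
  have hI : ∫ x in Ioi (0 : ℝ), (x : ℂ) ^ (s - 1) • Dc x =
      mellin (fun x ↦ (f x : ℂ)) s - C / (s - 1) := by
    have hlin : (fun x : ℝ ↦ (x : ℂ) ^ (s - 1) • Dc x) = fun x : ℝ ↦
        (x : ℂ) ^ (s - 1) • F x -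
          ∑ j : Fin J, (c j : ℂ) * ((x : ℂ) ^ (s - 1) • beurlingRhoTrunc (k j) x) := by
      funext x
      rw [hDc_eq, smul_eq_mul, smul_eq_mul, mul_sub, Finset.mul_sum]
      congr 1
      exact Finset.sum_congr rfl fun j _ ↦ by rw [smul_eq_mul]; ring
    have hint2 : ∀ j : Fin J, Integrable (fun x : ℝ ↦ (c j : ℂ) *
        ((x : ℂ) ^ (s - 1) • beurlingRhoTrunc (k j) x)) μ0 :=
      fun j ↦ (mellinConvergent_beurlingRhoTrunc _ hre).const_mul _
    rw [hlin, integral_sub hintF (integrable_finsetSum _ fun j _ ↦ hint2 j),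
      integral_finsetSum _ fun j _ ↦ hint2 j, ← hmellin]
    have h2 : ∀ j : Fin J, ∫ x in Ioi (0 : ℝ), (x : ℂ) ^ (s - 1) •
        beurlingRhoTrunc (k j) x = 1 / ((k j : ℂ) * (s - 1)) :=
      fun j ↦ hmel j
    rw [Finset.sum_congr rfl fun j _ ↦
      (integral_const_mul _ _).trans (congrArg (fun z ↦ (c j : ℂ) * z) (h2 j))]
    rw [hC]
    push_cast
    rw [Finset.sum_div]
    congr 1
    refine Finset.sum_congr rfl fun j _ ↦ ?_
    have hkj : (k j : ℂ) ≠ 0 :=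
      Complex.ofReal_ne_zero.2 (show (0 : ℝ) < k j by linarith [hk j]).ne'
    have hs2 : s - 1 ≠ 0 := sub_ne_zero.2 hs1
    field_simp
  ------------------------------------------------------------------
  -- (iii) Cauchy–Schwarz on `(0,1]`: the pairing has norm `≤ ε M`
  ------------------------------------------------------------------
  have hIle : ‖∫ x in Ioi (0 : ℝ), (x : ℂ) ^ (s - 1) • Dc x‖ ≤ ε * M := by
    have hprod : (fun x : ℝ ↦ (x : ℂ) ^ (s - 1) • Dc x) = Dc • g := by
      funext x
      simp only [Pi.smul_apply', smul_eq_mul, hDc, hg]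
      by_cases hx : x ∈ Ioc (0 : ℝ) 1
      · simp only [indicator_of_mem hx]; ring
      · simp only [indicator_of_notMem hx, mul_zero]
    have hDc2 : eLpNorm Dc 2 μ0 ≤ ENNReal.ofReal ε := by
      refine (eLpNorm_mono fun x ↦ ?_).trans hN.le
      simp only [hDc]
      refine (norm_indicator_le_norm_self _ _).trans ?_
      rw [Complex.norm_real]
    have hH : eLpNorm (Dc • g) 1 μ0 ≤ ENNReal.ofReal ε * eLpNorm g 2 μ0 :=
      (eLpNorm_smul_le_mul_eLpNorm hgm hDcm.aestronglyMeasurable).trans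
        (by gcongr)
    have hfin : ENNReal.ofReal ε * eLpNorm g 2 μ0 ≠ ⊤ :=
      ENNReal.mul_ne_top ENNReal.ofReal_ne_top hgL2.eLpNorm_lt_top.ne
    calc ‖∫ x in Ioi (0 : ℝ), (x : ℂ) ^ (s - 1) • Dc x‖
        ≤ (∫⁻ x in Ioi (0 : ℝ), ENNReal.ofReal ‖(x : ℂ) ^ (s - 1) • Dc x‖).toReal :=
          norm_integral_le_lintegral_norm _
      _ = (eLpNorm (Dc • g) 1 μ0).toReal := by
          rw [← hprod, eLpNorm_one_eq_lintegral_enorm]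
          simp_rw [ofReal_norm]
          rfl
      _ ≤ (ENNReal.ofReal ε * eLpNorm g 2 μ0).toReal := ENNReal.toReal_mono hfin hH
      _ = ε * M := by rw [ENNReal.toReal_mul, ENNReal.toReal_ofReal hε.le]
  ------------------------------------------------------------------
  -- combine
  ------------------------------------------------------------------
  have hCn : ‖(C : ℂ) / (s - 1)‖ ≤ ε * ‖(1 : ℂ) / (s - 1)‖ := by
    rw [norm_div, norm_div, norm_one, Complex.norm_real, Real.norm_eq_abs, ← div_eq_mul_one_div]
    exact div_le_div_of_nonneg_right hCε (norm_nonneg _)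
  calc ‖mellin (fun x ↦ (f x : ℂ)) s‖
      = ‖(mellin (fun x ↦ (f x : ℂ)) s - C / (s - 1)) + C / (s - 1)‖ := by rw [sub_add_cancel]
    _ ≤ ‖mellin (fun x ↦ (f x : ℂ)) s - C / (s - 1)‖ + ‖(C : ℂ) / (s - 1)‖ := norm_add_le _ _
    _ ≤ ε * M + ε * ‖(1 : ℂ) / (s - 1)‖ := add_le_add (hI ▸ hIle) hCn
    _ = ε * (M + ‖(1 : ℂ) / (s - 1)‖) := by ring

end Summit.RiemannHypothesis.RiemannHypothesis.Theorems.Splittings.NbDilationBudget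

end
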